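import Summits.CriticalPhenomena.PercolationContinuityZ3.Theorems.FK.Transplant.KNFreeSeedsLevels
import Summits.CriticalPhenomena.PercolationContinuityZ3.Theorems.FK.Transplant.KNFreeSeedsCube
import Summits.CriticalPhenomena.PercolationContinuityZ3.Theorems.FK.Transplant.KNFreeSeedsFkLaw
import HarnessLib

/-!
# FRONTIER TRANSPLANT, research line R-TP (row `h_tgt` = TP_FK, OPEN-2 by lead ruling L7), part 7: Kozma–Nitzan's Lemma 10 Steps II–III
# (seed manufacture with CUBE seeds) for the transplant's LAW OF RECORD `fkLaw Λ W q` — all hypotheses discharged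

Support file (`--supports stmt-CriticalPhenomena-4575`, helper) of the FRONTIER TRANSPLANT sub-cell (`fk-continuity/transplant/`, seat
`prim-bschramm-fkt-p1`); builds on p205010 (kernel theorem, internal audit signed; external expert review pending).  No definitions, no
named facts, no sorries; standard axioms.

HONEST FRAMING (page 1, cell rule; lead ruling L7).  The transplant's theorem of record is CONDITIONAL on FH (free-box hittability; open at
the same `p` for `q > 1`; GRC Conj. (5.103)-calibre via K1; barrier note `Literature.Barriers.CriticalPhenomena.SamePFreeBoundaryCriteria`)
AND on TP_FK (`KNFreeTargetHittable`, Kozma–Nitzan's target Lemma 10 for finite-volume FK laws; a theorem at `q = 1`, no derivation known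
for `q > 1`: the first-relay decoupling of KN p. 21 has no FK replacement — `FT03-DESIGN.md` §3/§7, `GG-REFUTED.md`).  The transplant is a
typed reduction, not a proof of FK continuity.  THIS FILE is unconditional: it is the part of TP_FK that IS a theorem for every `q ≥ 1` —
Steps I–III of KN's proof of Lemma 10 (arXiv:2401.12397, pp. 17–19), for the law of record, with the seed shape the launch-consumption Prop
`FKLaunchAt` needs (a wired cube).

**`KNFree.exists_level_real_cubeSeed_gt_fkLaw`.**  Let `hL : LHyp L W p D R` (KN's Lemma-10 data: box `B = [lo, hi]`, source `o ∉ D`, lattice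
subbox `D ⊇ B⟨R+1⟩`, finitely supported weighting `W` on `Sfin ⊆ Λ`), `0 < p < 1`, `1 ≤ q`, and `P = fkLaw Λ W q`.  If `P(o ↔ B) > 1 - δ`, the
level range `[j₀, j₁]`, `j₁ ≤ R`, has at least `(1-p)^{-2d·Ncont} / δ` levels, the levels are wide enough for the windows, and
`(1 - π^{s*})^k ≤ δ` with `π = p/(p + q(1-p))`, `s* = seedBound d M + 2d(2M+1)^d`, then at some level `j ∈ [j₀, j₁]`, with `P`-probability
`> 1 - 3δ`, some selected contact vertex `x` of the cluster of `o` outside `B⟨j⟩` carries a fully open CUBE SEED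
`L.seedE j M x ∪ edgesIn (zdGraph d) (L.cubeX j M x)` — whence `o ↔ x ↔` every vertex of the cube `L.cubeX j M x = GM.ball (L.vX j M x) M`
(`KNFree.openConn_of_cubeSeed_subset`), i.e. the cluster of `o` has acquired a wired cube seed of radius `M` inside `B⟨j⟩ ⊆ D`.
Proof: parts 1–6 — `KNFree.stepII` and `KNFree.real_manyContacts_diff_cubeSeeds_le` with their hypotheses `hnull` / `hdel` / `hins` supplied by
`KNFree.real_fkLaw_compl_posOnly_eq_zero` / `del_tolerance_fkLaw` / `ins_tolerance_fkLaw` (fkp-10b's weights-form finite energy p244352,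
transported along the lift p243920).  Every constant is a functional of `(p, q, d, M, k, δ)`; nothing refers to `θ⁰`/`φ⁰` (T1⁺).
[cite: KozmaNitzan2024, §4 Lemma 10, Steps II–III, eqs. (17)–(20) (pp. 18–19)] [cite: Grimmett2006, Thm. (3.1) eq. (3.4) (p. 38); Thm. (3.7) (p. 39); Thm. (4.17)(b) (p. 75)]
-/

noncomputable section

namespace Summit.CriticalPhenomena.PercolationContinuityZ3.Theorems.FK.KNFree

open MeasureTheory Set
open Literature.Probability.Percolation Literature.Probability.LatticeModels
open Literature.Probability.Percolation.KozmaNitzan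
open scoped Classical

variable {d : ℕ}

/-- **KOZMA–NITZAN LEMMA 10, STEPS II–III, FOR THE LAW OF RECORD `fkLaw Λ W q` WITH CUBE SEEDS** (`1 ≤ q`, `0 < p < 1`; see the module
docstring for the reading of the hypotheses): at some level `j ∈ [j₀, j₁]`, with probability `> 1 - 3δ`, a selected contact vertex of the
cluster of `o` outside `B⟨j⟩` carries a fully open cube seed. [cite: KozmaNitzan2024, §4 Lemma 10, Steps II–III, eqs. (17)–(20) (pp. 18–19)]
[cite: Grimmett2006, Thm. (3.1) eq. (3.4) (p. 38); Thm. (4.17)(b) (p. 75)] -/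
theorem exists_level_real_cubeSeed_gt_fkLaw [NeZero d] {q : ℝ} (hq : 1 ≤ q) (Λ : Finset (Site d))
    {p : unitInterval} (hp0 : 0 < (p : ℝ)) (hp1 : (p : ℝ) < 1)
    {L : LData d} {W : Sym2 (Site d) → unitInterval} {D : Finset (Site d)} {R : ℕ} (hL : LHyp L W p D R) (hΛ : L.Sfin ⊆ Λ)
    {M k j₀ j₁ : ℕ} (hj₁ : j₁ ≤ R) (hwide : ∀ j ∈ Finset.Icc j₀ j₁, ∀ i, L.Lo j i + 2 * M + 2 ≤ L.Hi j i)
    {δ : ℝ} (hJ : 1 / (1 - (p : ℝ)) ^ (2 * d * LData.Ncont d M k) ≤ δ * ((Finset.Icc j₀ j₁).card : ℝ))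
    (hk : (1 - ((p : ℝ) / (p + q * (1 - p))) ^ (seedBound d M + 2 * d * (2 * M + 1) ^ d)) ^ k ≤ δ)
    (hreach : 1 - δ < (fkLaw Λ W q).real L.reachB) :
    ∃ j ∈ Finset.Icc j₀ j₁, 1 - 3 * δ < (fkLaw Λ W q).real
      (⋃ x ∈ outerBoundary (zdGraph d) (L.X j), ({ω | x ∈ L.sel j M k ω} ∩
        {ω | (↑(L.seedE j M x ∪ edgesIn (zdGraph d) (L.cubeX j M x)) : Set (Sym2 (Site d))) ⊆ ω})) := by
  set μ := fkLaw Λ W q with hμ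
  have hq0 : 0 < q := one_pos.trans_le hq
  haveI : IsProbabilityMeasure μ := by
    rw [hμ]; unfold fkLaw
    haveI := isProbabilityMeasure_rcMeasureW (fun e : Sym2 ↥Λ => W (Sym2.map Subtype.val e)) hq0 (∅ : Set ↥Λ)
    exact Measure.isProbabilityMeasure_map (measurable_of_finite (liftEdges Λ)).aemeasurable
  -- pairs of weight `p` lie inside `Λ` (finite support, `p ≠ 0`)
  have hWΛ : ∀ F : Finset (Sym2 (Site d)), (∀ e ∈ F, W e = p) → ∀ e ∈ F, ∀ z ∈ e, z ∈ Λ := by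
    intro F hF e he z hz
    refine hΛ (forall_mem_of_finSupp hL.fin (fun h0 => ?_) z hz)
    have : ((W e : unitInterval) : ℝ) = 0 := by rw [h0]; rfl
    rw [hF e he] at this
    exact hp0.ne' this
  have hπ := insertionConst_mem_Icc' (p := (p : ℝ)) ⟨p.2.1, p.2.2⟩ hq
  -- the three hypotheses of the engine, for the law of record
  have hnull : μ.real (LData.PosOnly W)ᶜ = 0 := real_fkLaw_compl_posOnly_eq_zero hq Λ W
  have hdel : ∀ (F : Finset (Sym2 (Site d))) (A : Set (BondConfig (Site d))), (∀ e ∈ F, W e = p) → MeasurableSet A →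
      (1 - (p : ℝ)) ^ F.card * μ.real ((fun ω => ω \ ↑F) ⁻¹' A) ≤ μ.real A :=
    fun F A hF hA => del_tolerance_fkLaw hq Λ W hF (hWΛ F hF) hA
  have hins : ∀ (F : Finset (Sym2 (Site d))) (A : Set (BondConfig (Site d))), (∀ e ∈ F, W e = p) → MeasurableSet A →
      ((p : ℝ) / (p + q * (1 - p))) ^ F.card * μ.real ((fun ω => ω ∪ ↑F) ⁻¹' A) ≤ μ.real A :=
    fun F A hF hA => ins_tolerance_fkLaw hq Λ W hF (hWΛ F hF) hA
  -- Step II, then Step III with cube seeds at that level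
  obtain ⟨j, hj, hfail⟩ := stepII μ hL hnull hdel hp1 hj₁ hJ hreach
  refine ⟨j, hj, ?_⟩
  have hjR : j ≤ R := (Finset.mem_Icc.1 hj).2.trans hj₁
  have h3 := real_manyContacts_diff_cubeSeeds_le μ hL hπ.1 hπ.2 hins (j := j) (M := M) (k := k) hjR (hwide j hj)
  set G : Set (BondConfig (Site d)) := ⋃ x ∈ outerBoundary (zdGraph d) (L.X j), ({ω | x ∈ L.sel j M k ω} ∩
    {ω | (↑(L.seedE j M x ∪ edgesIn (zdGraph d) (L.cubeX j M x)) : Set (Sym2 (Site d))) ⊆ ω}) with hG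
  have hsplit : μ.real (L.Fail (LData.Ncont d M k) j)ᶜ ≤ μ.real ((L.Fail (LData.Ncont d M k) j)ᶜ \ G) + μ.real G := by
    calc μ.real (L.Fail (LData.Ncont d M k) j)ᶜ ≤ μ.real (((L.Fail (LData.Ncont d M k) j)ᶜ \ G) ∪ G) :=
          measureReal_mono (fun ω hω => by
            by_cases hωG : ω ∈ G
            · exact Or.inr hωG
            · exact Or.inl ⟨hω, hωG⟩) (measure_ne_top _ _)
      _ ≤ _ := measureReal_union_le _ _
  linarith
where
  /-- `π = p/(p + q(1-p)) ∈ [0,1]` (copy of `insertionConst_mem_Icc` of part 4, kept local to avoid an import). -/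
  insertionConst_mem_Icc' {p q : ℝ} (hp : p ∈ Set.Icc (0 : ℝ) 1) (hq : 1 ≤ q) : 0 ≤ p / (p + q * (1 - p)) ∧ p / (p + q * (1 - p)) ≤ 1 := by
    have hden := insertionDenominator_pos hp hq
    refine ⟨div_nonneg hp.1 hden.le, ?_⟩
    rw [div_le_one hden]
    nlinarith [hp.1, hp.2, hq]

end Summit.CriticalPhenomena.PercolationContinuityZ3.Theorems.FK.KNFree

end
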